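import Summits.ResolutionOfSingularities.ResolutionOfSingularities.Theorems.HomologicalConductorNoZenoRRelativelyMinimal
import HarnessLib

/-!
# Crux `NoZenoR` (stmt-ResolutionOfSingularities-19943) — the TOP blow-up of Zariski's factorisation, and the transfer
# of criterion (M) to strict transforms along an `S`-morphism MODULO Lipman's one-step exercise

Route `ResolutionOfSingularities/HomologicalConductor` (cell decomp-res, hand leafhand-res-homologicalconduct-18 g1).
OURS: AI-written proof over tree theorems, weaker than expert review; nothing here is a statement of the manuscript
under review (Hironaka 2017).  SUPPORT level, counted 0.  Def-free, no new named facts; the one-step exercise of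
Lipman p. 278 («(E·E)+χ(E) ≥ (E*·E*)+χ(E*)» under one quadratic transformation, in the form «(M) passes to the strict
transform») enters as an explicit binder `hex`.

* `exists_top_fac` — a NON-isomorphic `S`-morphism `h : W → Z₁` between desingularizations of the two-dimensional
  Noetherian local normal domain `S` factors as `h = e ≫ τ ≫ σ` with `e` an isomorphism, `τ : W′ → W₁` a blowing up of a
  closed point `x′` (`dim 𝒪_{W₁,x′} = 2`) of a DESINGULARIZATION `ρ₁ : W₁ → Spec S`, and `σ : W₁ → Z₁` an `S`-morphism (the
  last quadratic transformation of Zariski's factorisation, with the regularity of the intermediate surface recorded);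
* `criterionM_transfer_of_hex` — under `hex`, criterion (M) `3·h⁰(𝓘) < h⁰(𝓘²)` passes from an integral exceptional curve
  `E_η` of a desingularization `X` to every integral exceptional curve `η′` over `η` on any desingularization `W`
  mapping to `X` over `S` (induction along the one-step descent `FirstKind.step`).

No crux or summit statement is proved here.
-/

noncomputable section

-- single-problem summit: the doubled namespace component `ResolutionOfSingularities` is forced
set_option linter.dupNamespace false

open CategoryTheory AlgebraicGeometry TopologicalSpace Topology IsLocalRing
open Literature.AlgebraicGeometry.Resolution
open Scheme.IdealSheafData
open Summit.ResolutionOfSingularities.ResolutionOfSingularities.Theorems.NoZeno.ExcCount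
open Summit.ResolutionOfSingularities.ResolutionOfSingularities.Theorems.NoZeno.ExcCount.FirstKind

namespace Summit.ResolutionOfSingularities.ResolutionOfSingularities.Theorems.NoZeno.FirstKind

variable {S : Type} [CommRing S] [IsNoetherianRing S] [IsLocalRing S] [IsDomain S] [IsIntegrallyClosed S]

/-- **The top quadratic transformation of Zariski's factorisation.**  For `S` a two-dimensional Noetherian local normal
domain, `g₁ : Z₁ → Spec S` and `h ≫ g₁ : W → Spec S` desingularizations with `h` NOT an isomorphism: `h = e ≫ τ ≫ σ` where
`e : W ⥲ W′` is an isomorphism, `τ : W′ → W₁` is a blowing up of a closed point `x′` with `dim 𝒪_{W₁,x′} = 2` of a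
desingularization `ρ₁ : W₁ → Spec S` (and `τ ≫ ρ₁` is a desingularization), and `σ : W₁ → Z₁` satisfies `σ ≫ g₁ = ρ₁`.
Induction on `#excCurvePoints` along the one-step descent `FirstKind.step`.
[cite: StacksProject, Tag 0C5R]; [cite: Lipman1969, Corollary (27.3), proof (p. 278)] -/
theorem exists_top_fac (h2 : ringKrullDim S = 2) {W : Scheme.{0}} {π : W ⟶ Spec (.of S)} (hπ : IsResolution π) :
    ∀ (Z₁ : Scheme.{0}) (g₁ : Z₁ ⟶ Spec (.of S)) (h : W ⟶ Z₁), IsResolution g₁ → h ≫ g₁ = π → ¬ IsIso h →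
      ∃ (W₁ : Scheme.{0}) (ρ₁ : W₁ ⟶ Spec (.of S)) (σ : W₁ ⟶ Z₁) (x' : W₁) (hx' : IsClosed ({x'} : Set W₁))
        (W' : Scheme.{0}) (τ : W' ⟶ W₁) (e : W ⟶ W') (_ : IsIso e),
        IsResolution ρ₁ ∧ σ ≫ g₁ = ρ₁ ∧ ringKrullDim (W₁.presheaf.stalk x') = 2 ∧
          IsBlowup τ (vanishingIdeal ⟨{x'}, hx'⟩) ∧ IsResolution (τ ≫ ρ₁) ∧ e ≫ τ ≫ σ = h := by
  suffices H : ∀ (k : ℕ) (Z₁ : Scheme.{0}) (g₁ : Z₁ ⟶ Spec (.of S)) (h : W ⟶ Z₁), IsResolution g₁ → h ≫ g₁ = π →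
      ¬ IsIso h → (excCurvePoints π).ncard ≤ (excCurvePoints g₁).ncard + k →
      ∃ (W₁ : Scheme.{0}) (ρ₁ : W₁ ⟶ Spec (.of S)) (σ : W₁ ⟶ Z₁) (x' : W₁) (hx' : IsClosed ({x'} : Set W₁))
        (W' : Scheme.{0}) (τ : W' ⟶ W₁) (e : W ⟶ W') (_ : IsIso e),
        IsResolution ρ₁ ∧ σ ≫ g₁ = ρ₁ ∧ ringKrullDim (W₁.presheaf.stalk x') = 2 ∧
          IsBlowup τ (vanishingIdeal ⟨{x'}, hx'⟩) ∧ IsResolution (τ ≫ ρ₁) ∧ e ≫ τ ≫ σ = h from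
    fun Z₁ g₁ h hg₁ hh hne => H _ Z₁ g₁ h hg₁ hh hne (Nat.le_add_left _ _)
  intro k
  induction k with
  | zero =>
    intro Z₁ g₁ h hg₁ hh hne hle
    have := ncard_excCurvePoints_succ_le_of_not_isIso h2 hπ hg₁ hh hne
    omega
  | succ k ih =>
    intro Z₁ g₁ h hg₁ hh hne hle
    have hπ' : IsResolution (h ≫ g₁) := by rw [hh]; exact hπ
    obtain ⟨y, hy, hy2, Y₁, b, h₁, hb, hh₁, hbg⟩ := step h2 hπ' hg₁ hne
    have hfac₁ : h₁ ≫ b ≫ g₁ = π := by rw [← Category.assoc, hh₁, hh]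
    by_cases hiso : IsIso h₁
    · exact ⟨Z₁, g₁, 𝟙 Z₁, y, hy, Y₁, b, h₁, hiso, hg₁, Category.id_comp g₁, hy2, hb, hbg,
        by rw [Category.comp_id, hh₁]⟩
    · have hc2 := ncard_excCurvePoints_blowup_point h2 g₁ hg₁ hy hy2 b hb hbg
      obtain ⟨W₁, ρ₁, σ₁, x', hx', W', τ, e, he, hρ₁, hσ₁, hx'2, hτ, hτρ₁, hfac⟩ :=
        ih Y₁ (b ≫ g₁) h₁ hbg hfac₁ hiso (by omega)
      refine ⟨W₁, ρ₁, σ₁ ≫ b, x', hx', W', τ, e, he, hρ₁, by rw [Category.assoc, hσ₁], hx'2, hτ, hτρ₁, ?_⟩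
      rw [← Category.assoc τ σ₁ b, ← Category.assoc e, hfac, hh₁]

/-- **Criterion (M) passes to strict transforms along any `S`-morphism of desingularizations, MODULO the one-step
exercise.**  Assume `hex`: for every desingularization `g : Y → Spec S`, closed `y` with `dim 𝒪_{Y,y} = 2`, blowing up
`b : Y₁ → Y` of `y`, and `η₁ ∈ excCurvePoints (b ≫ g)` over `b η₁ ∈ excCurvePoints g`, (M) at `b η₁` implies (M) at `η₁`
(Lipman p. 278: «(E·E)+χ(E) = (E′·E′)+χ(E′) ≥ (E*·E*)+χ(E*)»).  Then for desingularizations `π : X → Spec S`,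
`q ≫ π : W → Spec S` and `η′ ∈ excCurvePoints (q ≫ π)` with `q η′ ∈ excCurvePoints π`: (M) at `q η′` ⇒ (M) at `η′`.
[cite: Lipman1969, Corollary (27.3), proof (p. 278)] -/
theorem criterionM_transfer_of_hex (h2 : ringKrullDim S = 2)
    (hex : ∀ ⦃Y : Scheme.{0}⦄ (g : Y ⟶ Spec (.of S)), IsResolution g →
      ∀ ⦃y : Y⦄ (hy : IsClosed ({y} : Set Y)), ringKrullDim (Y.presheaf.stalk y) = 2 →
      ∀ ⦃Y₁ : Scheme.{0}⦄ (b : Y₁ ⟶ Y), IsBlowup b (vanishingIdeal ⟨{y}, hy⟩) →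
      ∀ ⦃η₁ : Y₁⦄, η₁ ∈ excCurvePoints (b ≫ g) → b.base η₁ ∈ excCurvePoints g →
        3 * h0 g (primeDivisorIdeal (b.base η₁)) < h0 g (primeDivisorIdeal (b.base η₁) ^ 2) →
        3 * h0 (b ≫ g) (primeDivisorIdeal η₁) < h0 (b ≫ g) (primeDivisorIdeal η₁ ^ 2))
    {X : Scheme.{0}} {π : X ⟶ Spec (.of S)} (hπ : IsResolution π) :
    ∀ (W : Scheme.{0}) (q : W ⟶ X), IsResolution (q ≫ π) → ∀ η' ∈ excCurvePoints (q ≫ π),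
      q.base η' ∈ excCurvePoints π →
      3 * h0 π (primeDivisorIdeal (q.base η')) < h0 π (primeDivisorIdeal (q.base η') ^ 2) →
      3 * h0 (q ≫ π) (primeDivisorIdeal η') < h0 (q ≫ π) (primeDivisorIdeal η' ^ 2) := by
  suffices H : ∀ (k : ℕ) (X : Scheme.{0}) (π : X ⟶ Spec (.of S)), IsResolution π →
      ∀ (W : Scheme.{0}) (q : W ⟶ X), IsResolution (q ≫ π) →
      (excCurvePoints (q ≫ π)).ncard ≤ (excCurvePoints π).ncard + k → ∀ η' ∈ excCurvePoints (q ≫ π),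
      q.base η' ∈ excCurvePoints π →
      3 * h0 π (primeDivisorIdeal (q.base η')) < h0 π (primeDivisorIdeal (q.base η') ^ 2) →
      3 * h0 (q ≫ π) (primeDivisorIdeal η') < h0 (q ≫ π) (primeDivisorIdeal η' ^ 2) from
    fun W q hq η' hη' hqη' hM => H _ X π hπ W q hq (Nat.le_add_left _ _) η' hη' hqη' hM
  intro k
  induction k with
  | zero =>
    intro X π hπ W q hq hle η' hη' hqη' hM
    -- `q` is an isomorphism: transport
    have hiso : IsIso q := by
      by_contra hne
      have := ncard_excCurvePoints_succ_le_of_not_isIso h2 hq hπ rfl hne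
      omega
    exact transport X π W q hiso η' hM
  | succ k ih =>
    intro X π hπ W q hq hle η' hη' hqη' hM
    by_cases hiso : IsIso q
    · exact transport X π W q hiso η' hM
    · obtain ⟨y, hy, hy2, X₁, b, q₁, hb, hq₁, hbπ⟩ := step h2 hq hπ hiso
      have hc2 := ncard_excCurvePoints_blowup_point h2 π hπ hy hy2 b hb hbπ
      haveI : IsProper (b ≫ π) := hbπ.isProper
      haveI : IsProper π := hπ.isProper
      haveI : IsProper b := IsProper.of_comp b π
      -- the intermediate point `q₁ η'` is an exceptional curve of `b ≫ π` over `q η'`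
      have hbq₁ : b.base (q₁.base η') = q.base η' := by rw [← Scheme.Hom.comp_apply, hq₁]
      have hη₁ : q₁.base η' ∈ excCurvePoints (b ≫ π) := by
        have hover : (b ≫ π).base (q₁.base η') = closedPoint S := by
          rw [Scheme.Hom.comp_apply, hbq₁]; exact hqη'.1
        refine ⟨hover, le_antisymm (hbπ.height_le_one_of_base_eq_closedPoint h2 hover) ?_⟩
        refine Order.one_le_iff_ne_zero.mpr fun h0 => ?_
        have hcl : IsClosed ({b.base (q₁.base η')} : Set X) := by
          rw [← Set.image_singleton]
          exact b.isClosedMap _ (isClosed_singleton_of_height_eq_zero' h0)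
        rw [hbq₁] at hcl
        exact ((hπ.mem_excCurvePoints_iff h2).1 hqη').2 hcl
      have hM₁ : 3 * h0 (b ≫ π) (primeDivisorIdeal (q₁.base η')) <
          h0 (b ≫ π) (primeDivisorIdeal (q₁.base η') ^ 2) := by
        refine hex π hπ hy hy2 b hb hη₁ (by rw [hbq₁]; exact hqη') ?_
        rw [hbq₁]; exact hM
      have hq' : IsResolution (q₁ ≫ b ≫ π) := by rw [← Category.assoc, hq₁]; exact hq
      have hres := ih X₁ (b ≫ π) hbπ W q₁ hq' (by
        have : (excCurvePoints (q₁ ≫ b ≫ π)).ncard = (excCurvePoints (q ≫ π)).ncard := by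
          rw [← Category.assoc, hq₁]
        omega) η' (by rw [← Category.assoc, hq₁]; exact hη') hη₁ hM₁
      rw [← Category.assoc, hq₁] at hres
      exact hres
  where
  /-- transport of (M) along an isomorphism over `X` -/
  transport (X : Scheme.{0}) (π : X ⟶ Spec (.of S)) (W : Scheme.{0}) (q : W ⟶ X) (hiso : IsIso q) (η' : W)
      (hM : 3 * h0 π (primeDivisorIdeal (q.base η')) < h0 π (primeDivisorIdeal (q.base η') ^ 2)) :
      3 * h0 (q ≫ π) (primeDivisorIdeal η') < h0 (q ≫ π) (primeDivisorIdeal η' ^ 2) := by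
    have hsupp : ∀ K : X.IdealSheafData, (K.support : Set X) ⊆ Set.range q.base :=
      fun K z _ => (Scheme.homeoOfIso (asIso q)).surjective z
    rw [← comap_primeDivisorIdeal_of_isOpenImmersion q η', ← Literature.AlgebraicGeometry.Resolution.comap_pow,
      PointBlowup.h0_comap_of_isOpenImmersion π q _ (hsupp _),
      PointBlowup.h0_comap_of_isOpenImmersion π q _ (hsupp _)]
    exact hM

end Summit.ResolutionOfSingularities.ResolutionOfSingularities.Theorems.NoZeno.FirstKind

end
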